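import Literature.NumberTheory.GaloisRepresentations.GaloisRep
import Literature.NumberTheory.EllipticCurves.GaloisAction
import Literature.AlgebraicGeometry.PlaneCurves.WeierstrassChordTangent
import Mathlib.Topology.Instances.ZMod
import Mathlib.NumberTheory.NumberField.Basic
import HarnessLib

/-!
# Route `SqrtFiveQuarticCovers` (crux `RefinedLocusModular`, stmt-Langlands-17833): a Borel mod-`3`
# framing forces a `K`-rational root of the `3`-division polynomial

The named MODEL inputs of the route's record (`hK1c`, `hK1inf` of
`Theorems/SqrtFiveQuarticCoversRecordWeak5.lean`: «a `(b3, H8)`- resp. `(b3, e7)`-framing of `E`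
gives a `K`-point of the printed model of `X(b3,·)`») start from the moduli interpretation of
`X₀(3)`: a Borel framing of `E[3]` is a `Γ_K`-stable line, i.e. a `K`-rational `3`-isogeny.  This
file proves, with no named fact, the first algebraic rung of that interpretation in the route's
WRITTEN-OUT vocabulary (`FramedGaloisRep`, `geomTorsion`, the equivariant additive framing `e`):

* `exists_eval_Ψ₃_eq_zero_of_smul_eq_self_or_neg` — over a perfect field `K`, a point
  `Q ∈ E(K̄)` of order `3` with `σ • Q ∈ {Q, -Q}` for every `σ ∈ Gal(K̄/K)` has `x(Q) ∈ K`, a root of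
  the `3`-division polynomial `Ψ₃ = 3x⁴ + b₂x³ + 3b₄x² + 3b₆x + b₈` of `E`;
* `exists_eval_Ψ₃_eq_zero_of_borelThree` — if `ρ̄ : Γ_K → GL₂(𝔽₃)` is a framing of `E[3]`
  (`e (σ • P) = ρ̄(σ) · e P`) with all entries `(1,0)` equal to `0` (upper-triangular = Borel), then
  `Ψ₃(E)` has a root in `K` (the point `P = e⁻¹(1,0)` spans the stable line: `σ • P = ρ̄(σ)₀₀ P`);
* `exists_eval_Ψ₃_eq_zero_of_borelThree_framing` — the same for `E / 𝓞 K` over a number field,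
  hypothesis = the `b3`-binder of the route's cruxes VERBATIM.

Everything here is proved (Galois descent `K̄^{Γ_K} = K` for perfect `K`, Mathlib
`InfiniteGalois.mem_range_algebraMap_iff_fixed`; order `3` ⇔ flex ⇔ `Ψ₃(x) = 0`, the tree's
`Literature.AlgebraicGeometry.PlaneCurves.addOrderOf_eq_three_iff_Ψ₃_eval_eq_zero`).  HONEST STATUS:
a helper toward the N1 («modular curves») debt of stmt-Langlands-17833; it closes no stub and moves no
binder of RECORD v5; nothing here proves modularity of any curve.

References: J. H. Silverman, *The Arithmetic of Elliptic Curves*, GTM 106 (2009), III.§7–§8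
(Galois action on `E[m]`), Ex. 3.7 (division polynomials), I.§1 (Galois descent);
[FreitasLeHungSiksek2015] §2.2, §5.2 (the curves `X(b3, ·)`).
-/

noncomputable section

set_option linter.dupNamespace false -- project-wide option (lakefile weak.linter.dupNamespace); `Summit.Langlands.Langlands` is the mandated namespace

open scoped Classical
open scoped Matrix NumberField

universe u

namespace Summit.Langlands.Langlands.Theorems.SqrtFiveQuarticCovers

open WeierstrassCurve Literature.NumberTheory.GaloisRepresentations

/-- **Galois descent for a stable pair `{Q, -Q}` of `3`-torsion points.**  Let `K` be a perfect
field, `V` a Weierstrass curve over `K`, and `Q ∈ V(K̄)` a point of order `3` such that every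
`σ ∈ Gal(K̄/K)` maps `Q` to `Q` or to `-Q` (i.e. the subgroup `{O, Q, -Q}` is `Γ_K`-stable).  Then
the `x`-coordinate of `Q` lies in `K` and is a root of the `3`-division polynomial `Ψ₃` of `V`:
`∃ x₀ : K, Ψ₃(V)(x₀) = 0`.  Proof: `x(σ • Q) = σ(x(Q))` and `x(-Q) = x(Q)`, so `x(Q)` is fixed by
`Γ_K`, hence `K`-rational (`K̄/K` is Galois for `K` perfect); order `3` means `Q` is a flex, i.e.
`Ψ₃(x(Q)) = 0`, and `Ψ₃` commutes with base change.
[cite: SilvermanAEC2009, III.§7 and Ex. 3.7; I.§1] -/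
theorem exists_eval_Ψ₃_eq_zero_of_smul_eq_self_or_neg {K : Type u} [Field K] [PerfectField K]
    (V : WeierstrassCurve K) (Q : (V.baseChange (AlgebraicClosure K)).toAffine.Point)
    (hQ3 : addOrderOf Q = 3)
    (hσ : ∀ σ : AlgebraicClosure K ≃ₐ[K] AlgebraicClosure K, σ • Q = Q ∨ σ • Q = -Q) :
    ∃ x₀ : K, V.Ψ₃.eval x₀ = 0 := by
  haveI : IsGalois K (AlgebraicClosure K) := {}
  rcases Q with _ | ⟨x, y, hxy⟩
  · -- the origin has order `1`
    exact absurd hQ3 (by rw [show (Affine.Point.zero : (V.baseChange (AlgebraicClosure K)).toAffine.Point)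
        = 0 from rfl, addOrderOf_zero]; decide)
  · have hΨ : (V.baseChange (AlgebraicClosure K)).Ψ₃.eval x = 0 :=
      (Literature.AlgebraicGeometry.PlaneCurves.addOrderOf_eq_three_iff_Ψ₃_eval_eq_zero _ hxy).1 hQ3
    -- `x` is fixed by every `σ`
    have hx : ∀ σ : AlgebraicClosure K ≃ₐ[K] AlgebraicClosure K, σ x = x := by
      intro σ
      rcases hσ σ with h | h
      · rw [WeierstrassCurve.smul_def, Affine.Point.map_some] at h
        exact (Affine.Point.some.inj h).1
      · rw [WeierstrassCurve.smul_def, Affine.Point.map_some, Affine.Point.neg_some] at h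
        exact (Affine.Point.some.inj h).1
    obtain ⟨x₀, hx₀⟩ := (InfiniteGalois.mem_range_algebraMap_iff_fixed x).mpr hx
    refine ⟨x₀, ?_⟩
    have h0 : algebraMap K (AlgebraicClosure K) (V.Ψ₃.eval x₀) = 0 := by
      rw [← Polynomial.eval₂_at_apply, ← Polynomial.eval_map, ← WeierstrassCurve.map_Ψ₃, hx₀]
      exact hΨ
    exact (map_eq_zero_iff _ (algebraMap K (AlgebraicClosure K)).injective).1 h0

/-- **A Borel mod-`3` framing gives a `K`-rational root of `Ψ₃`.**  Let `K` be a perfect field,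
`V` a Weierstrass curve over `K`, `ρ̄ : Γ_K →ₜ* GL₂(𝔽₃)` a framed mod-`3` representation and
`e : V[3](K̄) ≃+ 𝔽₃²` an equivariant framing of the geometric `3`-torsion
(`e (σ • P) = ρ̄(σ) *ᵥ e P`).  If `ρ̄` is upper triangular (`ρ̄(σ)₁₀ = 0` for all `σ`), then the
`3`-division polynomial of `V` has a root in `K`.  Proof: `P := e⁻¹(1,0)` satisfies
`e (σ • P) = ρ̄(σ) *ᵥ (1,0) = (ρ̄(σ)₀₀, 0) = ρ̄(σ)₀₀ · (1,0)`, and `ρ̄(σ)₀₀ ∈ {1, 2}` (`0` would give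
`σ • P = O`, i.e. `P = O`), so `σ • P = P` or `σ • P = 2P = -P`; `P ≠ O` and `3P = O` give order
`3`; conclude by `exists_eval_Ψ₃_eq_zero_of_smul_eq_self_or_neg`.
[cite: SilvermanAEC2009, III.§7–§8] [cite: FreitasLeHungSiksek2015, §2.2] -/
theorem exists_eval_Ψ₃_eq_zero_of_borelThree {K : Type} [Field K] [PerfectField K]
    (V : WeierstrassCurve K) (ρ : FramedGaloisRep K (ZMod 3) 2)
    (e : V.geomTorsion ((3 : ℕ) : ℤ) ≃+ (Fin 2 → ZMod 3))
    (he : ∀ (σ : Field.absoluteGaloisGroup K) (P : V.geomTorsion ((3 : ℕ) : ℤ)),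
      e (σ • P) = ((ρ σ : GL (Fin 2) (ZMod 3)) : Matrix (Fin 2) (Fin 2) (ZMod 3)) *ᵥ (e P))
    (hB : ∀ σ : Field.absoluteGaloisGroup K,
      (((ρ σ : GL (Fin 2) (ZMod 3)) : Matrix (Fin 2) (Fin 2) (ZMod 3)) 1 0 = 0)) :
    ∃ x₀ : K, V.Ψ₃.eval x₀ = 0 := by
  -- the first basis vector and the point it frames
  set v : Fin 2 → ZMod 3 := Pi.single 0 1 with hv
  set P : V.geomTorsion ((3 : ℕ) : ℤ) := e.symm v with hPdef
  have heP : e P = v := e.apply_symm_apply v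
  have hv0 : v ≠ 0 := by
    intro h
    have := congrFun h 0
    rw [hv, Pi.single_eq_same] at this
    exact one_ne_zero this
  have hP0 : P ≠ 0 := by
    intro h
    apply hv0
    rw [← heP, h, map_zero]
  -- the column `ρ̄(σ) *ᵥ v` is `ρ̄(σ)₀₀ • v`
  have hcol : ∀ σ : Field.absoluteGaloisGroup K,
      ((ρ σ : GL (Fin 2) (ZMod 3)) : Matrix (Fin 2) (Fin 2) (ZMod 3)) *ᵥ v =
        (((ρ σ : GL (Fin 2) (ZMod 3)) : Matrix (Fin 2) (Fin 2) (ZMod 3)) 0 0) • v := by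
    intro σ
    ext i
    fin_cases i
    · simp [hv, Matrix.mulVec, dotProduct, Fin.sum_univ_two]
    · simp [hv, Matrix.mulVec, dotProduct, Fin.sum_univ_two, hB σ]
  -- every `σ` moves `P` to `P` or `-P`
  have hσP : ∀ σ : Field.absoluteGaloisGroup K, σ • P = P ∨ σ • P = -P := by
    intro σ
    have h1 : e (σ • P) = (((ρ σ : GL (Fin 2) (ZMod 3)) : Matrix (Fin 2) (Fin 2) (ZMod 3)) 0 0) • v := by
      rw [he, heP, hcol]
    generalize ha : (((ρ σ : GL (Fin 2) (ZMod 3)) : Matrix (Fin 2) (Fin 2) (ZMod 3)) 0 0) = a at h1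
    rcases (by decide : ∀ b : ZMod 3, b = 0 ∨ b = 1 ∨ b = 2) a with h0 | h1' | h2
    · -- `a = 0`: `σ • P = 0`, contradicting `P ≠ 0`
      exfalso
      rw [h0, zero_smul] at h1
      have h2 : σ • P = 0 := by
        apply e.injective
        rw [h1, map_zero]
      exact hP0 ((smul_eq_zero_iff_eq σ).1 h2)
    · left
      apply e.injective
      rw [h1, heP, h1', one_smul]
    · right
      apply e.injective
      rw [h1, map_neg, heP, h2]
      have key : ∀ c : ZMod 3, (2 : ZMod 3) * c = -c := by
        intro c
        fin_cases c <;> rfl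
      ext i
      simp only [Pi.smul_apply, smul_eq_mul, Pi.neg_apply]
      exact key (v i)
  -- pass to the underlying geometric point `Q = ↑P ∈ V(K̄)`
  have hQ0 : (P : V.geomPoints) ≠ 0 := fun h => hP0 (Subtype.ext h)
  have hQ3' : (3 : ℕ) • (P : V.geomPoints) = 0 := by
    rw [← natCast_zsmul]
    exact (Submodule.mem_torsionBy_iff _ _).1 P.2
  haveI : Fact (Nat.Prime 3) := ⟨Nat.prime_three⟩
  have hQ3 : addOrderOf (P : V.geomPoints) = 3 := addOrderOf_eq_prime hQ3' hQ0
  have hσQ : ∀ σ : AlgebraicClosure K ≃ₐ[K] AlgebraicClosure K,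
      σ • (show (V.baseChange (AlgebraicClosure K)).toAffine.Point from (P : V.geomPoints)) =
          (show (V.baseChange (AlgebraicClosure K)).toAffine.Point from (P : V.geomPoints)) ∨
        σ • (show (V.baseChange (AlgebraicClosure K)).toAffine.Point from (P : V.geomPoints)) =
          -(show (V.baseChange (AlgebraicClosure K)).toAffine.Point from (P : V.geomPoints)) := by
    intro σ
    rcases hσP σ with h | h
    · left
      have := congrArg (fun R : V.geomTorsion ((3 : ℕ) : ℤ) => (R : V.geomPoints)) h
      exact this
    · right
      have := congrArg (fun R : V.geomTorsion ((3 : ℕ) : ℤ) => (R : V.geomPoints)) h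
      exact this
  exact exists_eval_Ψ₃_eq_zero_of_smul_eq_self_or_neg V _ hQ3 hσQ

/-- **The `b3`-binder of the route's cruxes forces a `K`-rational root of `Ψ₃(E ⊗ K)`.**  For a
number field `K` and `E / 𝓞 K`: if `E[3]` admits a framing `ρ̄ : Γ_K →ₜ* GL₂(𝔽₃)`
(`WeierstrassCurve.IsTorsionGaloisRep 3 ρ̄`, written out as in
`Summit.Langlands.Langlands.Theses.SqrtFiveQuarticCovers.RefinedLocusModular`) whose image is upper
triangular (all `(1,0)` entries `0`), then `∃ x₀ : K, Ψ₃(E ⊗ K)(x₀) = 0` — equivalently (Silverman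
Ex. 3.7) `E ⊗ K` has a `K`-rational subgroup of order `3`, the moduli meaning of a `K`-point of
`X₀(3)`.  The hypothesis is the `b3`-binder of the route's cruxes VERBATIM; this is the first rung of the
MODEL inputs `hK1c` / `hK1inf` of RECORD v5 (which remain named).  Proof:
`exists_eval_Ψ₃_eq_zero_of_borelThree`.
[cite: SilvermanAEC2009, III.§7, Ex. 3.7] [cite: FreitasLeHungSiksek2015, §2.2, §5.2] -/
theorem exists_eval_Ψ₃_eq_zero_of_borelThree_framing (K : Type) [Field K] [NumberField K]
    (E : WeierstrassCurve (𝓞 K))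
    (h3 : ∃ ρ : Literature.NumberTheory.GaloisRepresentations.FramedGaloisRep K (ZMod 3) 2,
      (∃ e : (E.baseChange K).geomTorsion ((3 : ℕ) : ℤ) ≃+ (Fin 2 → ZMod 3),
        ∀ (σ : Field.absoluteGaloisGroup K) (P : (E.baseChange K).geomTorsion ((3 : ℕ) : ℤ)),
          e (σ • P) = ((ρ σ : GL (Fin 2) (ZMod 3)) : Matrix (Fin 2) (Fin 2) (ZMod 3)) *ᵥ (e P)) ∧
      (∀ σ : Field.absoluteGaloisGroup K,
        (((ρ σ : GL (Fin 2) (ZMod 3)) : Matrix (Fin 2) (Fin 2) (ZMod 3)) 1 0 = 0))) :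
    ∃ x₀ : K, (E.baseChange K).Ψ₃.eval x₀ = 0 := by
  obtain ⟨ρ, ⟨e, he⟩, hB⟩ := h3
  exact exists_eval_Ψ₃_eq_zero_of_borelThree (E.baseChange K) ρ e he hB

end Summit.Langlands.Langlands.Theorems.SqrtFiveQuarticCovers

end
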